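import Summits.HodgeConjecture.CorCM.HypDel.ExtAmbientReceptacleQArchA
import Summits.HodgeConjecture.CorCM.HypDel.ExtAmbientReceptacleLevelForm
import Literature.AlgebraicGeometry.ShimuraVarieties.UnitaryAuxiliaryExtLevelQuotient
import Literature.AlgebraicGeometry.ModuliOfAbelianVarieties.SiegelRationalModelHeckeAction
import Literature.AlgebraicGeometry.Motives.ComplexPointsTower
import Literature.AlgebraicGeometry.ShimuraVarieties.UnitaryAuxiliaryTorusClassNumberProofs
import HarnessLib

/-!
# T3 `stub_Squot`, step D3 — EQUIVARIANCE of the product-level embedding `ι′` for the level action (source, ★ Q4) and the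
# integral Hecke action (target, ★ D2b) ([Deligne1971TravauxShimura] Prop. 1.15, §5 (5.11.1); [Milne2005ShimuraVarieties] Thm. 13.6)

Cell `hodgecm-mathlib`, crux `HDel` (stmt-HodgeConjecture-24835), T3 v4.2 «Q-architecture», stub `stub_Squot : QArch.SQuot` (owner B-p06; KEY
`wake/KEY-hodgecm-mathlib-B-p06-t3-stub-squot.md` §D3).  HELPER toward that stub (`--supports stmt-HodgeConjecture-24835 --as helper`); theorems
only, 0 `def`, 0 named fact, 0 instance, 0 `sorry`.  HC_CM is proved only modulo the 7 printed citations until rung 0 closes; nothing here is a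
proof of I-1′ or of `HDel`.

THE SITUATION (D1–D4 of the KEY).  `Γ := K × L₀` acts on the product level `Y := Sh_{K_V×L_V}(G × T₀(M), X × {h_Φ})_ℂ` by ★ Q4
`Aux.complexSystemExt_isLevelQuotient`: `(k, l) · ([x, aK_V], [t]) = ([x, a k⁻¹ K_V], [l t])`; the integral Hecke operators of the Siegel `ℚ`-model act
by ★ D2b `SiegelRationalModel.exists_heckeAction`: `act₀ γ : [J, a] ↦ [J, a γ⁻¹]` (`γ ∈ K_δ(1)`); and `ι′ : Y ⟶ Sg.Mc_{KN}` satisfies the point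
formula `QArch.PointFormulaN`: `([x, aK_V], [t]) ↦ [J_x, ũ(a,t)·KN]`.  Reading `(k,l) · ([x,aK_V],[t])` through `ι′` gives
`[J_x, ũ(a k⁻¹, l t)] = [J_x, ũ(a,t) · ũ(k⁻¹, l)] = [J_x, ũ(a,t) · γ⁻¹]` with **`γ = ũ(k, l⁻¹)`** — so the comparison homomorphism
`θ : Γ →* K_δ(1)` is `(k, l) ↦ ũ(k, l⁻¹)` (a homomorphism because `T₀(M)(𝔸_f)` is commutative), well defined by `K × L₀ ≤ K̃(1) = ũ⁻¹ K_δ(1)`.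
This file proves:
* (the homomorphism `θ` with `θ(k,l) = ũ(k, l⁻¹)` is ★ `Aux.exists_hom_principalLevelSubgroup_one`, `UnitaryAuxiliaryTwistedLevelHom`, B-p18
  p647875 — it enters the theorems below only through the hypothesis `hθ`);
* `map_hecke_map_towerIso_inv_map_eInv` — the Hecke operator transported to `((R.Nm KN) ⊗_ℚ E) ⊗_E ℂ` acts on the
  `towerIso⁻¹ ∘ e⁻¹`-image of `[J, a]` as `[J, a γ⁻¹]` — on POINTS, through ★ `pointsOfForm_towerPointEquiv`, ★ (T-c) `towerPointEquiv_map`,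
  ★ (N1) `pointsOfForm_symm_map_baseChange_map` and ★ `ptQ_def` (no morphism-level unfolding of the tower isomorphism: kernel note of
  ★ `AbelianVarietyBaseChangeTowerFst`);
* `heckeAut_eq_one_of_mem` — `act₀ γ = 1` for `γ ∈ KN` (`[J, aγ⁻¹ KN] = [J, a KN]`; a `ℚ`-endomorphism of the quasi-projective model with smooth
  complex fibre is determined by its complex points, ★ `SchemeOver.hom_ext_of_forall_algPoints` + ★ `exists_eq_ptQ_mk`) — so the Hecke action
  through `θ` kills `K_V × L_V = K̃(N)`, as the level action does (Q4), and both descend to the finite `Δ := Γ/(K_V × L_V)`;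
* `iotaPrime_comp_hecke_eq` — **D3**: for every `g ∈ Γ`,
  `(ι′ ≫ e⁻¹ ≫ towerIso⁻¹) ≫ ((act₀ (θ g)) ⊗_ℚ E) ⊗_E ℂ = (act_Y g) ≫ (ι′ ≫ e⁻¹ ≫ towerIso⁻¹)` as morphisms
  `Y ⟶ ((R.Nm KN) ⊗_ℚ E) ⊗_E ℂ` — exactly the equivariance hypothesis `hf` of ★ D4 `Motives.exists_isClosedImmersion_desc_of_isSepQuotient` for
  `f := ι′ ≫ e⁻¹ ≫ towerIso⁻¹` (complex points separate morphisms out of the smooth projective `Y` into the separated target; every point of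
  `Y` is `([x, aK_V], [t])`, ★ `exists_summandPointExt_eq`; naturality of ★ `Motives.towerIso`).
[cite: Deligne1971TravauxShimura, Prop. 1.15 p. 132; §5 (5.11.1) p. 159; 4.17 p. 150] [cite: Milne2005ShimuraVarieties, Thm. 13.6 p. 118; Lemma 5.13 p. 57; (33) p. 58]
-/

noncomputable section

open Function MulAction Topology NumberField IsDedekindDomain CategoryTheory CategoryTheory.Limits Matrix
  AlgebraicGeometry
open scoped Matrix ComplexOrder
open Literature.AlgebraicGeometry Literature.AlgebraicGeometry.Motives Literature.AlgebraicGeometry.HodgeTheory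
open Literature.NumberTheory.Automorphic Literature.NumberTheory.Automorphic.UnitaryGroup
open Literature.NumberTheory.Automorphic.Liu2021.AppendixC (C5.OpenCompactSubgroup C5.SmallLevel)
open Literature.Geometry.ComplexHyperbolic Literature.Geometry.ComplexHyperbolic.BallModel
open Literature.AlgebraicGeometry.ShimuraVarieties Literature.AlgebraicGeometry.ShimuraVarieties.UnitaryCanonicalModel
open Literature.AlgebraicGeometry.ShimuraVarieties.UnitaryCanonicalModel.Aux
open Literature.AlgebraicGeometry.ModuliOfAbelianVarieties

namespace Summit.HodgeConjecture.CorCM.HypDel.ExtReceptacle.QArch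

set_option autoImplicit false
set_option backward.isDefEq.respectTransparency false

/-! ### §1. The integral Hecke operators: triviality at level `KN` (the homomorphism `θ(k,l) = ũ(k, l⁻¹)` is ★ B-p18 `Aux.exists_hom_principalLevelSubgroup_one`, p647875) -/

section Hecke

variable {g : ℕ} {δ : Fin g → ℕ} {Sg : SiegelComplexRecordSystem g δ}

/-- `[J, a γ⁻¹ KN] = [J, a KN]` for `γ ∈ KN` (right cosets). [cite: Milne2005ShimuraVarieties, §5 (5.1) p. 56] -/
theorem siegelShimuraSet_mk_mul_inv_of_mem (KN : SiegelLevel δ) (J : C0pm δ) (a γ : gspFinAdelic δ) (hγ : γ ∈ KN.1) :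
    SiegelShimuraSet.mk δ KN.1 J (a * γ⁻¹) = SiegelShimuraSet.mk δ KN.1 J a := by
  rw [SiegelShimuraSet.mk_eq_mk_iff]
  refine ⟨1, by rw [map_one, conjAct_one], ?_⟩
  rw [map_one, one_smul]
  exact (QuotientGroup.eq.2 (by rw [_root_.mul_inv_rev, inv_inv, inv_mul_cancel_right]; exact hγ)).symm

/-- **The Hecke operator `act₀ γ` is the IDENTITY for `γ ∈ KN`**: on the `ℚ`-structure points it is `[J, aKN] ↦ [J, aγ⁻¹KN] = [J, aKN]`, and a
`ℚ`-endomorphism of the quasi-projective model `R.Nm KN` (separated, locally of finite type, reduced since its complex fibre `Sg.Mc KN` is smooth)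
is determined by its complex points (★ `SchemeOver.hom_ext_of_forall_algPoints`; every complex point is `R.ptQ` of a class, ★ `exists_eq_ptQ_mk`).
Hence the Hecke action through `θ` kills `K_V × L_V = ũ⁻¹ K_δ(N)`. [cite: Milne2005ShimuraVarieties, Thm. 13.6 p. 118; Rem. 5.29 (c) p. 65]
[cite: Deligne1971TravauxShimura, Déf. 3.1 p. 136; 4.17 p. 150] -/
theorem heckeAut_eq_one_of_mem (R : SiegelRationalModel g δ Sg) (KN : SiegelLevel δ)
    (act₀ : ↥(principalLevelSubgroup δ 1) →* Aut (R.Nm.obj KN))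
    (h₀ : ∀ (γ : ↥(principalLevelSubgroup δ 1)) (J : C0pm δ) (a : gspFinAdelic δ),
        AlgPoints.map (act₀ γ).hom (R.ptQ KN ((Sg.pts KN).symm (SiegelShimuraSet.mk δ KN.1 J a))) =
          R.ptQ KN ((Sg.pts KN).symm (SiegelShimuraSet.mk δ KN.1 J
            (a * ((γ⁻¹ : ↥(principalLevelSubgroup δ 1)) : gspFinAdelic δ)))))
    (γ : ↥(principalLevelSubgroup δ 1)) (hγ : (γ : gspFinAdelic δ) ∈ KN.1) : act₀ γ = 1 := by
  -- the instances making complex points faithful on `ℚ`-endomorphisms (as in ★ D2b)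
  haveI : IsSeparated (R.Nm.obj KN).hom := isSeparated_hom_of_isQuasiProjectiveOver (R.quasiProjective KN)
  haveI : LocallyOfFiniteType (R.Nm.obj KN).hom := locallyOfFiniteType_hom_of_isQuasiProjectiveOver (R.quasiProjective KN)
  haveI : Smooth (Sg.Mc.obj KN).hom := Sg.smooth KN
  haveI : IsReduced (Sg.Mc.obj KN).left := isReduced_of_smooth_over_field (Sg.Mc.obj KN).hom
  haveI : IsIso (R.e.hom.app KN).left := (inferInstance : IsIso ((Over.forget _).mapIso (R.e.app KN)).hom)
  haveI : IsReduced ((Motives.baseChangeHom (algebraMap ℚ ℂ)).obj (R.Nm.obj KN)).left :=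
    isReduced_of_isOpenImmersion (R.e.hom.app KN).left
  haveI : IsReduced (R.Nm.obj KN).left := isReduced_of_baseChangeHom (algebraMap ℚ ℂ) (R.Nm.obj KN)
  refine Iso.ext ?_
  change (act₀ γ).hom = 𝟙 (R.Nm.obj KN)
  apply SchemeOver.hom_ext_of_forall_algPoints ℂ
  intro P
  obtain ⟨J, a, rfl⟩ := R.exists_eq_ptQ_mk KN P
  rw [Category.comp_id]
  change AlgPoints.map (act₀ γ).hom _ = _
  have hinv : ((γ⁻¹ : ↥(principalLevelSubgroup δ 1)) : gspFinAdelic δ) = (γ : gspFinAdelic δ)⁻¹ := rfl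
  rw [h₀ γ J a, hinv, siegelShimuraSet_mk_mul_inv_of_mem KN J a _ hγ]

end Hecke

/-! ### §2. D3: equivariance of `ι′ ≫ e⁻¹ ≫ towerIso⁻¹` -/

section Equivariance

variable {L : Type} [Field L] [NumberField L] [IsCMField L]
variable {H : Matrix (Fin 3) (Fin 3) L} {τ : L →+* ℂ} {T : GL (Fin 3) ℂ}
  {hT : formCongr (starRingEnd ℂ) T (H.map τ) = BallModel.J}
  {K₀ : C5.OpenCompactSubgroup ↥(finAdelic (↥(maximalRealSubfield L)) L (IsCMField.complexConj L) 3 H)}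
variable (M : Type) [Field M] [NumberField M] [IsCMField M] {j : L →+* M} {ξ₀ ξ : M} {g : ℕ} {δ : Fin g → ℕ}

/-- **The `towerIso⁻¹ ∘ e⁻¹`-image of a complex point of `Sg.Mc KN`, read through the `E`-structure of `(R.Nm KN) ⊗_ℚ E`**, is the
`E`-structure point over the `ℚ`-structure point `R.ptQ KN S` (★ `pointsOfForm_towerPointEquiv` + ★ `ptQ_def`): the normal form
through which the transported Hecke operators are computed on points. [cite: Milne2005ShimuraVarieties, §13 p. 117] -/
theorem pointsOfForm_towerPointEquiv_ptQ {g : ℕ} {δ : Fin g → ℕ} {Sg : SiegelComplexRecordSystem g δ}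
    (R : SiegelRationalModel g δ Sg) (KN : SiegelLevel δ) (E : IntermediateField ℚ ℂ) (S : ComplexPoints (Sg.Mc.obj KN)) :
    pointsOfForm ((Motives.baseChange ℚ ↥E).obj (R.Nm.obj KN)) (towerPointEquiv E (R.Nm.obj KN) (R.ptQ KN S)) =
      AlgPoints.map (towerIso E (R.Nm.obj KN)).inv (AlgPoints.map (R.e.inv.app KN) S) := by
  rw [pointsOfForm_towerPointEquiv, SiegelRationalModel.ptQ_def, Equiv.apply_symm_apply]

/-- **(N1) forward: an `E`-morphism base-changed to `ℂ` acts on points read through the forms** —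
`(jA ⊗_E ℂ)(pointsOfForm N Q) = pointsOfForm A (jA Q)` (★ `pointsOfForm_symm_map_baseChange_map`). [cite: Milne2005ShimuraVarieties, §13 p. 117] -/
theorem map_baseChange_pointsOfForm {E : IntermediateField ℚ ℂ} {N A : SchemeOver ↥E} (jA : N ⟶ A) (Q : ComplexPoints N) :
    AlgPoints.map ((Motives.baseChange ↥E ℂ).map jA) (pointsOfForm N Q) = pointsOfForm A (AlgPoints.map jA Q) := by
  apply (pointsOfForm A).symm.injective
  rw [pointsOfForm_symm_map_baseChange_map, Equiv.symm_apply_apply, Equiv.symm_apply_apply]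

/-- **The Hecke operator transported to `((R.Nm KN) ⊗_ℚ E) ⊗_E ℂ` acts on `towerIso⁻¹ ∘ e⁻¹`-points by the right translate**:
for `act₀ γ` acting on the `ℚ`-structure points by `[J, a] ↦ [J, a γ⁻¹]` (★ D2b `exists_heckeAction`), `((act₀ γ) ⊗_ℚ E) ⊗_E ℂ` sends the
point `towerIso⁻¹ e⁻¹ [J, a]` to `towerIso⁻¹ e⁻¹ [J, a γ⁻¹]` — computed on points through `pointsOfForm_towerPointEquiv_ptQ`, (N1) and ★ (T-c)
`towerPointEquiv_map`, so that the tower isomorphism is never unfolded at the level of morphisms.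
[cite: Milne2005ShimuraVarieties, Thm. 13.6 p. 118; §13 p. 117] [cite: Deligne1971TravauxShimura, Déf. 3.1 p. 136] -/
theorem map_hecke_map_towerIso_inv_map_eInv {g : ℕ} {δ : Fin g → ℕ} {Sg : SiegelComplexRecordSystem g δ}
    (R : SiegelRationalModel g δ Sg) (KN : SiegelLevel δ)
    (act₀ : ↥(principalLevelSubgroup δ 1) →* Aut (R.Nm.obj KN))
    (h₀ : ∀ (γ : ↥(principalLevelSubgroup δ 1)) (J : C0pm δ) (a : gspFinAdelic δ),
        AlgPoints.map (act₀ γ).hom (R.ptQ KN ((Sg.pts KN).symm (SiegelShimuraSet.mk δ KN.1 J a))) =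
          R.ptQ KN ((Sg.pts KN).symm (SiegelShimuraSet.mk δ KN.1 J
            (a * ((γ⁻¹ : ↥(principalLevelSubgroup δ 1)) : gspFinAdelic δ)))))
    (γ : ↥(principalLevelSubgroup δ 1)) (J : C0pm δ) (a : gspFinAdelic δ) (E : IntermediateField ℚ ℂ) :
    AlgPoints.map ((Motives.baseChange ↥E ℂ).map ((Motives.baseChange ℚ ↥E).map (act₀ γ).hom))
        (AlgPoints.map (towerIso E (R.Nm.obj KN)).inv
          (AlgPoints.map (R.e.inv.app KN) ((Sg.pts KN).symm (SiegelShimuraSet.mk δ KN.1 J a)))) =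
      AlgPoints.map (towerIso E (R.Nm.obj KN)).inv
        (AlgPoints.map (R.e.inv.app KN) ((Sg.pts KN).symm (SiegelShimuraSet.mk δ KN.1 J
          (a * ((γ⁻¹ : ↥(principalLevelSubgroup δ 1)) : gspFinAdelic δ))))) := by
  rw [← pointsOfForm_towerPointEquiv_ptQ, ← pointsOfForm_towerPointEquiv_ptQ, map_baseChange_pointsOfForm,
    ← towerPointEquiv_map, h₀]

/-- **D3 — EQUIVARIANCE of `f := ι′ ≫ e⁻¹ ≫ towerIso⁻¹ : Y ⟶ ((R.Nm KN) ⊗_ℚ E) ⊗_E ℂ`** for the level action `act_Y` of `Γ = K × L₀` on the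
product level `Y = Sh_{K_V×L_V}(G × T₀(M), X × {h_Φ})_ℂ` (★ Q4, its point formula is `hY`) and the integral Hecke action `act₀` of `K_δ(1)`
on the Siegel `ℚ`-model (★ D2b, its point formula is `h₀`) pulled back along `θ(k,l) = ũ(k, l⁻¹)` (`hθ`) and base-changed to `E` and to `ℂ`:
for every `g ∈ Γ`, `f ≫ ((act₀ (θ g)) ⊗_ℚ E) ⊗_E ℂ = act_Y g ≫ f` — the hypothesis `hf` of ★ `Motives.exists_isClosedImmersion_desc_of_isSepQuotient`.
Proof: complex points separate morphisms `Y ⟶ Z` (`Y` smooth projective over `ℂ` as a finite disjoint union of the `Sc.Mc_{K_V}`, hence reduced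
and of finite type; `Z` separated); every point of `Y` is `([x, aK_V], [t])`; then `PointFormulaN`, `hY`, naturality of `towerIso⁻¹`,
`map_hecke_map_towerIso_inv_map_eInv` and `ũ(a k⁻¹, l t) = ũ(a,t) · ũ(k, l⁻¹)⁻¹`.
[cite: Deligne1971TravauxShimura, Prop. 1.15 p. 132; §5 (5.11.1) p. 159] [cite: Milne2005ShimuraVarieties, Thm. 13.6 p. 118; Lemma 5.13 p. 57; (33) p. 58] -/
theorem iotaPrime_comp_hecke_eq (Sc : ComplexRecordSystem L H τ T hT K₀) (Φ : CMType M) (F : SymplecticFrame M j H ξ₀ ξ g δ)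
    (hJ : ∀ x : Ball, auxComplexStructure F τ Φ T x ∈ C0pm δ)
    {LV : C5.OpenCompactSubgroup ↥(torusFinAdelic M)} {KV : C5.SmallLevel K₀}
    {K : Subgroup ↥(finAdelic (↥(maximalRealSubfield L)) L (IsCMField.complexConj L) 3 H)} {L₀ : Subgroup ↥(torusFinAdelic M)}
    (actY : (↥K × ↥L₀) →* Aut ((complexSystemExt M Sc LV).obj KV))
    (hY : ∀ (k : ↥K) (l : ↥L₀) (p' : classGroup M LV) (x : Ball)
        (a : finAdelic (↥(maximalRealSubfield L)) L (IsCMField.complexConj L) 3 H),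
        AlgPoints.map (actY (k, l)).hom (summandPointExt M Sc LV KV p' x a) =
          summandPointExt M Sc LV KV (classOf M LV (l : ↥(torusFinAdelic M)) * p') x
            (a * ((k : finAdelic (↥(maximalRealSubfield L)) L (IsCMField.complexConj L) 3 H))⁻¹))
    (Sg : SiegelComplexRecordSystem g δ) (R : SiegelRationalModel g δ Sg) (KN : SiegelLevel δ)
    (act₀ : ↥(principalLevelSubgroup δ 1) →* Aut (R.Nm.obj KN))
    (h₀ : ∀ (γ : ↥(principalLevelSubgroup δ 1)) (J : C0pm δ) (a : gspFinAdelic δ),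
        AlgPoints.map (act₀ γ).hom (R.ptQ KN ((Sg.pts KN).symm (SiegelShimuraSet.mk δ KN.1 J a))) =
          R.ptQ KN ((Sg.pts KN).symm (SiegelShimuraSet.mk δ KN.1 J
            (a * ((γ⁻¹ : ↥(principalLevelSubgroup δ 1)) : gspFinAdelic δ)))))
    (θ : (↥K × ↥L₀) →* ↥(principalLevelSubgroup δ 1))
    (hθ : ∀ g : ↥K × ↥L₀, ((θ g : ↥(principalLevelSubgroup δ 1)) : ↥(gspFinAdelic δ)) =
        auxToGspFin F ((g.1 : ↥(finAdelic (↥(maximalRealSubfield L)) L (IsCMField.complexConj L) 3 H)),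
          ((g.2 : ↥(torusFinAdelic M)))⁻¹))
    (E : IntermediateField ℚ ℂ) (ι' : (complexSystemExt M Sc LV).obj KV ⟶ Sg.Mc.obj KN)
    (hpf : PointFormulaN M Sc Φ F hJ LV KV Sg KN ι') (g : ↥K × ↥L₀) :
    (ι' ≫ R.e.inv.app KN ≫ (towerIso E (R.Nm.obj KN)).inv) ≫
        (Motives.baseChange ↥E ℂ).map ((Motives.baseChange ℚ ↥E).map (act₀ (θ g)).hom) =
      (actY g).hom ≫ (ι' ≫ R.e.inv.app KN ≫ (towerIso E (R.Nm.obj KN)).inv) := by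
  classical
  obtain ⟨k, l⟩ := g
  -- instances: `Y` reduced and locally of finite type (smooth projective), the target separated
  haveI : Finite (classGroup M LV) := finite_classGroup_printed_holds M LV
  have hYproj : IsProjectiveOver ((complexSystemExt M Sc LV).obj KV) :=
    Motives.isProjectiveOver_of_isColimit_cofan (coproductIsCoproduct fun _ : classGroup M LV => Sc.Mc.obj KV)
      fun _ => Sc.projective KV
  have hYsm : SmoothOfRelativeDimension 2 ((complexSystemExt M Sc LV).obj KV).hom :=
    Motives.smoothOfRelativeDimension_of_isColimit_cofan (coproductIsCoproduct fun _ : classGroup M LV => Sc.Mc.obj KV)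
      fun _ => Sc.smooth KV
  haveI : IsProper ((complexSystemExt M Sc LV).obj KV).hom := hYproj.isProper
  haveI : Smooth ((complexSystemExt M Sc LV).obj KV).hom := SmoothOfRelativeDimension.smooth 2 _
  haveI : IsReduced ((complexSystemExt M Sc LV).obj KV).left :=
    isReduced_of_smooth_over_field ((complexSystemExt M Sc LV).obj KV).hom
  haveI : IsSeparated (R.Nm.obj KN).hom := isSeparated_hom_of_isQuasiProjectiveOver (R.quasiProjective KN)
  haveI : IsSeparated ((Motives.baseChange ℚ ↥E).obj (R.Nm.obj KN)).hom := by
    change IsSeparated (pullback.snd _ _)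
    infer_instance
  haveI : IsSeparated ((Motives.baseChange ↥E ℂ).obj ((Motives.baseChange ℚ ↥E).obj (R.Nm.obj KN))).hom := by
    change IsSeparated (pullback.snd _ _)
    infer_instance
  apply SchemeOver.hom_ext_of_forall_algPoints ℂ
  intro P
  obtain ⟨p', x, a, rfl⟩ := exists_summandPointExt_eq M Sc LV KV P
  obtain ⟨t, ht⟩ : ∃ t : ↥(torusFinAdelic M), classOf M LV t = p' := QuotientGroup.mk'_surjective _ p'
  subst ht
  change AlgPoints.map _ (summandPointExt M Sc LV KV (classOf M LV t) x a) =
    AlgPoints.map _ (summandPointExt M Sc LV KV (classOf M LV t) x a)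
  simp only [AlgPoints.map_comp_apply]
  -- the source side: the level action then the point formula
  rw [hY k l (classOf M LV t) x a, hpf (classOf M LV t) x a t rfl,
    hpf (classOf M LV (l : ↥(torusFinAdelic M)) * classOf M LV t) x
      (a * ((k : finAdelic (↥(maximalRealSubfield L)) L (IsCMField.complexConj L) 3 H))⁻¹)
      ((l : ↥(torusFinAdelic M)) * t) (map_mul _ _ _)]
  -- the target side: the transported Hecke operator on `towerIso⁻¹ ∘ e⁻¹`-points
  rw [map_hecke_map_towerIso_inv_map_eInv R KN act₀ h₀]
  -- the adelic identity `ũ(a,t) · θ(k,l)⁻¹ = ũ(a k⁻¹, l t)`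
  have hγ : (((θ (k, l))⁻¹ : ↥(principalLevelSubgroup δ 1)) : ↥(gspFinAdelic δ)) =
      auxToGspFin F (((k : finAdelic (↥(maximalRealSubfield L)) L (IsCMField.complexConj L) 3 H))⁻¹,
        (l : ↥(torusFinAdelic M))) := by
    rw [Subgroup.coe_inv, hθ, ← map_inv, Prod.inv_mk, inv_inv]
  have hprod : auxToGspFin F (a, t) *
      auxToGspFin F (((k : finAdelic (↥(maximalRealSubfield L)) L (IsCMField.complexConj L) 3 H))⁻¹,
        (l : ↥(torusFinAdelic M))) =
      auxToGspFin F (a * ((k : finAdelic (↥(maximalRealSubfield L)) L (IsCMField.complexConj L) 3 H))⁻¹,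
        (l : ↥(torusFinAdelic M)) * t) := by
    rw [← map_mul, Prod.mk_mul_mk, mul_comm t]
  rw [hγ, hprod]

end Equivariance

end Summit.HodgeConjecture.CorCM.HypDel.ExtReceptacle.QArch

end
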